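import Mathlib.Data.ZMod.QuotientGroup
import Literature.Computability.Cryptography.HallgrenClassGroupQuantumKernel
import Literature.Computability.Cryptography.HallgrenClassGroupFormGroup
import Literature.NumberTheory.EllipticCurves.HeegnerPointsImaginaryQuadraticProofs
import HarnessLib

/-!
# Hallgren 2005 / class groups — the quantum sub-problem on a ONE-element generator list is the
# order of one form class

Topic `Literature/Computability/Cryptography`; proof companion of `HallgrenClassGroupQuantumKernel.lean`
(namespace `Literature.Computability.Cryptography.Hallgren2005`). Theorems only; no named fact.

The kernel of `HallgrenClassGroupQuantumKernel.lean` (`kitaevClFamily`, `kernelProb_clOrderEst_ge`)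
answers, on an instance `(d, L)`, the number `clGenOrder d L` = the order of the subgroup of the form
class group `Cl(−d)` generated by the reduced forms of `L` (`genOrder_eq_card_closure'`). Torsion-
witness samplers (decide `3 ∣ h(−d)` by the order of ONE near-uniform random class) use it with a
one-element list; this file records that special case in the three currencies of the tree:

* `clGenOrder_singleton` — `clGenOrder d [q] = ord [q]` in `Cl(O_{−d})` (`OrderCl.classOf'`, every
  negative discriminant);
* `clGenOrder_singleton_eq_orderOf_classOf` — `= ord [𝔞_q]` in `Cl(𝓞_K)` for an imaginary
  quadratic `K` of discriminant `−d` (`FormComposition.classOf`, `genOrder_eq_card_closure`);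
* `clGenOrder_singleton_dvd_classNumber` — hence `clGenOrder d [q] ∣ h(−d)` for a negative
  fundamental discriminant `−d` (so `3 ∣ clGenOrder d [q] → 3 ∣ h(−d)`: a torsion witness is sound).

## References

* D. A. Cox, *Primes of the form x² + ny²*, 2nd ed. (2013), §7.B Thm. 7.7 (forms ↔ ideal classes)
  [Cox2013].
* A. M. Childs, W. van Dam, Rev. Mod. Phys. 82 (2010), §5.7 (the class group: unique representatives,
  orders by phase estimation) [ChildsVandam2010].
* K. K. H. Cheung, M. Mosca, QIC 1 (2001), §3 [CheungMosca2001].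
-/

noncomputable section

namespace Literature.Computability.Cryptography.Hallgren2005

open Literature.NumberTheory.QuadraticFields.Quadratic Literature.NumberTheory.QuadraticFields.Quadratic.BinQF
open OrderCl FormComposition

/-- **`clGenOrder d [q] = ord [q]` in `Cl(O_{−d})`** (every negative discriminant): on an instance
with a one-element list the answer of the quantum sub-problem is the order of the class of the form
`q` (`genOrder_eq_card_closure'`, the closure of one class is its cyclic subgroup, `Nat.card_zpowers`).
[cite: ChildsVandam2010, §5.7] -/
theorem clGenOrder_singleton {d : ℕ} {q : ℕ × ℤ × ℕ} (h : IsClInstance d [q]) :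
    clGenOrder d [q] = orderOf (classOf' (negDiscrOf h.1) (toForm q)) := by
  obtain ⟨hd, hD4, hL⟩ := h
  have hL' : ∀ f ∈ [q].map toForm, f.IsPosPrim (negDiscrOf hd).D ∧ f.IsReduced := by
    intro f hf
    simp only [List.map_cons, List.map_nil, List.mem_singleton] at hf
    subst hf
    exact hL q (List.mem_singleton_self q)
  have key : genOrder (-(d : ℤ)) ([q].map toForm) =
      Nat.card (Subgroup.closure ((classOf' (negDiscrOf hd)) '' {g | g ∈ [q].map toForm})) :=
    genOrder_eq_card_closure' (negDiscrOf hd) hL' hD4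
  have himg : (classOf' (negDiscrOf hd)) '' {g | g ∈ [q].map toForm} =
      {classOf' (negDiscrOf hd) (toForm q)} := by
    ext c
    simp only [List.map_cons, List.map_nil, List.mem_singleton, Set.setOf_eq_eq_singleton,
      Set.image_singleton, Set.mem_singleton_iff]
  show genOrder (-(d : ℤ)) ([q].map toForm) = _
  rw [key, himg, ← Subgroup.zpowers_eq_closure, Nat.card_zpowers]

/-- **`clGenOrder d [q] = ord [𝔞_q]` in `Cl(𝓞_K)`**: for an imaginary quadratic field `K` with
canonical integral basis `(1, ω)` and a reduced primitive positive definite form `q` of discriminant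
`d_K = −d`, the answer on `(d, [q])` is the order of the ideal class of `q`
(`FormComposition.classOf`, `genOrder_eq_card_closure`). [cite: Cox2013, §7.B Thm. 7.7] -/
theorem clGenOrder_singleton_eq_orderOf_classOf {K : Type*} [Field K] [NumberField K]
    (hK : Literature.NumberTheory.EllipticCurves.IsImaginaryQuadratic K)
    (b : Module.Basis (Fin 2) ℤ (NumberField.RingOfIntegers K)) (hb : b 0 = 1)
    (hω : b 1 * b 1 = (mOf (NumberField.discr K) : NumberField.RingOfIntegers K) +
      (NumberField.discr K : NumberField.RingOfIntegers K) * b 1)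
    {d : ℕ} (hKd : NumberField.discr K = -(d : ℤ)) {q : ℕ × ℤ × ℕ}
    (hq : (toForm q).IsPosPrim (-(d : ℤ)) ∧ (toForm q).IsReduced) :
    clGenOrder d [q] = orderOf (classOf b hb (toForm q)) := by
  have hL : ∀ f ∈ [q].map toForm, f.IsPosPrim (NumberField.discr K) ∧ f.IsReduced := by
    intro f hf
    simp only [List.map_cons, List.map_nil, List.mem_singleton] at hf
    subst hf
    rw [hKd]
    exact hq
  rw [clGenOrder, ← hKd, genOrder_eq_card_closure b hb hω hK hL]
  have himg : (classOf b hb) '' {g | g ∈ [q].map toForm} = {classOf b hb (toForm q)} := by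
    ext c
    simp only [List.map_cons, List.map_nil, List.mem_singleton, Set.setOf_eq_eq_singleton,
      Set.image_singleton, Set.mem_singleton_iff]
  rw [himg, ← Subgroup.zpowers_eq_closure, Nat.card_zpowers]

/-- **A torsion witness is sound: `clGenOrder d [q] ∣ h(−d)`** for a negative fundamental
discriminant `−d` and a reduced primitive positive definite form `q` of discriminant `−d`
(`h(−d) = #Cl(𝓞_K)`, `IsNegFundamentalDiscr.classNumber_eq_card_classGroup`, Lagrange).
[cite: Cox2013, §7.B Thm. 7.7] -/
theorem clGenOrder_singleton_dvd_classNumber {d : ℕ} (hd : IsNegFundamentalDiscr d)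
    {q : ℕ × ℤ × ℕ} (hq : (toForm q).IsPosPrim (-(d : ℤ)) ∧ (toForm q).IsReduced) :
    clGenOrder d [q] ∣ Literature.NumberTheory.QuadraticFields.BinaryQuadraticForm.classNumber (-(d : ℤ)) := by
  classical
  obtain ⟨K, _, _, h2, hK⟩ := hd.exists_numberField
  have hIQ : Literature.NumberTheory.EllipticCurves.IsImaginaryQuadratic K :=
    Literature.NumberTheory.EllipticCurves.isImaginaryQuadratic_iff_discr_neg.2
      ⟨h2, hK ▸ hd.neg_lt_zero⟩
  obtain ⟨b, hb, hω⟩ := exists_basis_canonical h2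
  rw [clGenOrder_singleton_eq_orderOf_classOf hIQ b hb hω hK hq, hd.classNumber_eq_card_classGroup h2 hK]
  exact orderOf_dvd_card

/-- In particular **`3 ∣ clGenOrder d [q] → 3 ∣ h(−d)`**: on a negative fundamental discriminant with
`3 ∤ h(−d)` no valid one-form instance has answer divisible by `3`. [cite: CheungMosca2001, §3] -/
theorem three_dvd_classNumber_of_three_dvd_clGenOrder {d : ℕ} (hd : IsNegFundamentalDiscr d)
    {q : ℕ × ℤ × ℕ} (hq : (toForm q).IsPosPrim (-(d : ℤ)) ∧ (toForm q).IsReduced)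
    (h3 : 3 ∣ clGenOrder d [q]) :
    3 ∣ Literature.NumberTheory.QuadraticFields.BinaryQuadraticForm.classNumber (-(d : ℤ)) :=
  h3.trans (clGenOrder_singleton_dvd_classNumber hd hq)

end Literature.Computability.Cryptography.Hallgren2005

end
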